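import Literature.Probability.LatticeModels.ProdBernoulliIndependence
import Literature.Probability.Percolation.PercolationProofs
import Literature.Probability.Percolation.PercolationEvents
import Summits.CriticalPhenomena.PercolationContinuityZ3.Theorems.PercNearOneGluingNoHeavyLowerTailOneLayerTwoFingerTools
import HarnessLib

/-!
# The three-point variance row `(3PT)` when `c` separates `a` from `b` — every finite weighted graph

Support file for crux `stmt-CriticalPhenomena-4575` (`NoHeavyLowerTail`), seat `prim-l12-p1` gen 16 (`--supports stmt-CriticalPhenomena-4575`).
Memo `run/shared/lean/prim/prim-l12/FROM-prim-l12-p1-g16-SHARP-3PT.md` §2.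

Bond percolation `μ = prodBernoulli w` (arbitrary pair weights, finite vertex type `V`), distinct `a b c`.  The three-point variance row
`(3PT)  P(a↔b)·P(a↮b) ≤ P(a↔b, a↮c) + P(a↔c, a↮b) + P(b↔c, a↮b)` (gen 15; kernel for `n ≤ 5`; conjectured ∀n) is proved here on EVERY finite
weighted graph in which `c` SEPARATES `a` from `b`: there is a vertex set `S ∋ a`, `b, c ∉ S`, such that every pair between `S` and `V ∖ (S ∪ {c})`
has weight `0` (both sides arbitrary).  This is the family on which the memo's transport ratio is `≤ 1/4` and on which the refuted product
sharpening `(H2)` is tight.  Proof [this work]: off a null set, `{a↔c} = R_A`, `{b↔c} = R_B` (reachability inside the two sides), independent, and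
`{a↔b} = R_A ∩ R_B`; with `α = P(R_A)`, `β = P(R_B)` the claim is `αβ(1−αβ) ≤ α(1−β) + β(1−α)`, i.e.
`α(1−β)² + β(1−α)² + αβ(1−α)(1−β) ≥ 0`.

Main results: `walk_to_c_inside`, `openConn_ab_iff`, `threePointVariance_cutVertex` (the displayed inequality).
-/

namespace Summit.CriticalPhenomena.PercolationContinuityZ3.Theorems.ThreePointVarianceCutVertex

open MeasureTheory Set
open Literature.Probability.Percolation Literature.Probability.LatticeModels

variable {V : Type*} [Fintype V] [DecidableEq V]

/-- The non-diagonal pairs inside the vertex set `T`. [this work] -/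
def pairsIn (T : Finset V) : Finset (Sym2 V) := Finset.univ.filter fun e => (∀ x ∈ e, x ∈ T) ∧ ¬ e.IsDiag

/-- The configuration restricted to the pairs inside `T`. [this work] -/
def restr (T : Finset V) (ω : BondConfig V) : BondConfig V := ω ∩ ↑(pairsIn T)

/-- `x ↔ c` using only pairs inside `T`. [this work] -/
def reachIn (T : Finset V) (x c : V) : Set (BondConfig V) := {ω | (openGraph (restr T ω)).Reachable x c}

/-- The null event: an open pair between `S` and the far side `V ∖ (S ∪ {c})`. [this work] -/
def bad (S : Finset V) (c : V) : Set (BondConfig V) := {ω | ∃ u v, u ∈ S ∧ v ∉ S ∧ v ≠ c ∧ s(u, v) ∈ ω}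

/-- The pairs between `S` and the far side. [this work] -/
def badPairs (S : Finset V) (c : V) : Finset (Sym2 V) :=
  (S ×ˢ (Finset.univ.filter fun v => v ∉ S ∧ v ≠ c)).image fun uv => s(uv.1, uv.2)

section walks
variable {S : Finset V} {c : V} {ω : BondConfig V}

/-- Reachability inside `T` is reachability. [this work] -/
theorem reachable_of_reachIn {T : Finset V} {x y : V} (h : (openGraph (restr T ω)).Reachable x y) : (openGraph ω).Reachable x y := by
  refine h.mono fun u v huv => ?_
  rw [openGraph_adj] at huv ⊢
  exact ⟨huv.1.1, huv.2⟩

/-- An open pair with both endpoints in `T` is an edge of the restricted open graph. [this work] -/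
theorem adj_restr {T : Finset V} {u v : V} (huv : (openGraph ω).Adj u v) (hu : u ∈ T) (hv : v ∈ T) : (openGraph (restr T ω)).Adj u v := by
  rw [openGraph_adj] at huv ⊢
  refine ⟨⟨huv.1, ?_⟩, huv.2⟩
  simp only [Finset.mem_coe, pairsIn, Finset.mem_filter, Finset.mem_univ, true_and, Sym2.mem_iff, Sym2.mk_isDiag_iff]
  exact ⟨fun x hx => by rcases hx with rfl | rfl <;> assumption, huv.2⟩

/-- **Walks from the `a`-side reach `c` inside `S ∪ {c}`** (off the null event). [this work] -/
theorem walk_to_c_inside (hc : c ∉ S) (hN : ω ∉ bad S c) :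
    ∀ {u v : V} (_ : (openGraph ω).Walk u v), v = c → u ∈ S → ω ∈ reachIn (insert c S) u c := by
  intro u v p
  induction p with
  | nil => intro hv hu; exact (hc (hv ▸ hu)).elim
  | @cons u z v' h p' ih =>
    intro hv hu
    by_cases hz : z = c
    · subst hz
      exact (adj_restr h (Finset.mem_insert_of_mem hu) (Finset.mem_insert_self _ _)).reachable
    · by_cases hzS : z ∈ S
      · exact (adj_restr h (Finset.mem_insert_of_mem hu) (Finset.mem_insert_of_mem hzS)).reachable.trans (ih hv hzS)
      · exact (hN ⟨u, z, hu, hzS, hz, ((openGraph_adj ω u z).1 h).1⟩).elim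

/-- **Walks from the far side reach `c` inside `V ∖ S`** (off the null event). [this work] -/
theorem walk_to_c_outside (hN : ω ∉ bad S c) :
    ∀ {u v : V} (_ : (openGraph ω).Walk u v), v = c → u ∉ S → ω ∈ reachIn (Finset.univ.filter fun x => x ∉ S) u c := by
  intro u v p
  induction p with
  | nil => intro hv _; subst hv; exact SimpleGraph.Reachable.refl _
  | @cons u z v' h p' ih =>
    intro hv hu
    by_cases hzS : z ∈ S
    · have h' := (openGraph_adj ω u z).1 h
      by_cases huc : u = c
      · subst huc; exact SimpleGraph.Reachable.refl _
      · exact (hN ⟨z, u, hzS, hu, huc, by rw [Sym2.eq_swap]; exact h'.1⟩).elim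
    · have hu' : u ∈ Finset.univ.filter fun x => x ∉ S := by simp [hu]
      have hz' : z ∈ Finset.univ.filter fun x => x ∉ S := by simp [hzS]
      exact (adj_restr h hu' hz').reachable.trans (ih hv hzS)

omit [Fintype V] in
/-- **An open `a`–`b` path passes through `c`** (off the null event): for `a ∈ S`, `b ∉ S`. [this work] -/
theorem through_c (hN : ω ∉ bad S c) {b : V} (hb : b ∉ S) :
    ∀ {u v : V} (_ : (openGraph ω).Walk u v), v = b → u ∈ S → (openGraph ω).Reachable u c ∧ (openGraph ω).Reachable c b := by
  intro u v p
  induction p with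
  | nil => intro hv hu; exact (hb (hv ▸ hu)).elim
  | @cons u z v' h p' ih =>
    intro hv hu
    by_cases hz : z = c
    · subst hz; subst hv; exact ⟨h.reachable, ⟨p'⟩⟩
    · by_cases hzS : z ∈ S
      · obtain ⟨h1, h2⟩ := ih hv hzS
        exact ⟨h.reachable.trans h1, h2⟩
      · exact (hN ⟨u, z, hu, hzS, hz, ((openGraph_adj ω u z).1 h).1⟩).elim

variable {a b : V}

/-- Off the null event: `a ↔ c` iff `a ↔ c` inside `S ∪ {c}`. [this work] -/
theorem openConn_ac_iff (ha : a ∈ S) (hc : c ∉ S) (hN : ω ∉ bad S c) : ω ∈ openConn a c ↔ ω ∈ reachIn (insert c S) a c :=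
  ⟨fun ⟨p⟩ => walk_to_c_inside hc hN p rfl ha, fun h => reachable_of_reachIn h⟩

/-- Off the null event: `b ↔ c` iff `b ↔ c` inside `V ∖ S`. [this work] -/
theorem openConn_bc_iff (hb : b ∉ S) (hN : ω ∉ bad S c) :
    ω ∈ openConn b c ↔ ω ∈ reachIn (Finset.univ.filter fun x => x ∉ S) b c :=
  ⟨fun ⟨p⟩ => walk_to_c_outside hN p rfl hb, fun h => reachable_of_reachIn h⟩

omit [Fintype V] in
/-- Off the null event: `a ↔ b` iff `a ↔ c` and `b ↔ c`. [this work] -/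
theorem openConn_ab_iff (ha : a ∈ S) (hb : b ∉ S) (hN : ω ∉ bad S c) :
    ω ∈ openConn a b ↔ ω ∈ openConn a c ∧ ω ∈ openConn b c := by
  constructor
  · rintro ⟨p⟩
    obtain ⟨h1, h2⟩ := through_c hN hb p rfl ha
    exact ⟨h1, h2.symm⟩
  · rintro ⟨h1, h2⟩
    exact SimpleGraph.Reachable.trans h1 (SimpleGraph.Reachable.symm h2)

end walks

section det

/-- `reachIn T x c` is determined by the pairs inside `T`. [this work] -/
theorem determinedBy_reachIn (T : Finset V) (x c : V) : DeterminedBy (reachIn T x c) (↑(pairsIn T) : Set (Sym2 V)) := by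
  rw [determinedBy_iff]
  intro ω ω' h
  have hr : restr T ω = restr T ω' := h
  simp only [reachIn, mem_setOf_eq, hr]

/-- The pairs inside `S ∪ {c}` and inside `V ∖ S` are disjoint (for `c ∉ S`). [this work] -/
theorem disjoint_pairsIn (S : Finset V) (c : V) (hc : c ∉ S) :
    Disjoint (pairsIn (insert c S)) (pairsIn (Finset.univ.filter fun x => x ∉ S)) := by
  rw [Finset.disjoint_left]
  intro e he he'
  simp only [pairsIn, Finset.mem_filter, Finset.mem_univ, true_and, Finset.mem_insert] at he he'
  induction e using Sym2.ind with
  | h x y =>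
    have hx := he.1 x (Sym2.mem_mk_left x y)
    have hy := he.1 y (Sym2.mem_mk_right x y)
    have hx' := he'.1 x (Sym2.mem_mk_left x y)
    have hy' := he'.1 y (Sym2.mem_mk_right x y)
    rcases hx with rfl | hx
    · rcases hy with rfl | hy
      · exact he.2 rfl
      · exact hy' hy
    · exact hx' hx

end det

section prob
variable (w : Sym2 V → unitInterval) (S : Finset V) (c : V)

/-- The null event has probability `0` when all pairs between `S` and the far side have weight `0`. [this work] -/
theorem real_bad (hw : ∀ u ∈ S, ∀ v, v ∉ S → v ≠ c → (w s(u, v) : ℝ) = 0) : (prodBernoulli w).real (bad S c) = 0 := by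
  have hsub : bad S c = {ω : BondConfig V | ∃ e ∈ badPairs S c, e ∈ ω} := by
    ext ω
    simp only [bad, badPairs, mem_setOf_eq, Finset.mem_image, Finset.mem_product, Finset.mem_filter, Finset.mem_univ, true_and,
      Prod.exists]
    constructor
    · rintro ⟨u, v, hu, hv, hvc, h⟩; exact ⟨_, ⟨u, v, ⟨hu, hv, hvc⟩, rfl⟩, h⟩
    · rintro ⟨_, ⟨u, v, ⟨hu, hv, hvc⟩, rfl⟩, h⟩; exact ⟨u, v, hu, hv, hvc, h⟩
  refine le_antisymm ?_ measureReal_nonneg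
  rw [hsub]
  refine le_trans (prodBernoulli_real_exists_mem_le_sum w (badPairs S c)) (le_of_eq (Finset.sum_eq_zero fun e he => ?_))
  obtain ⟨⟨u, v⟩, huv, rfl⟩ := Finset.mem_image.1 he
  simp only [Finset.mem_product, Finset.mem_filter, Finset.mem_univ, true_and] at huv
  exact hw u huv.1 v huv.2.1 huv.2.2

omit [DecidableEq V] in
/-- Removing a null event does not change probabilities. [this work] -/
theorem real_inter_compl_of_null {N : Set (BondConfig V)} (hN : (prodBernoulli w).real N = 0) (X : Set (BondConfig V)) :
    (prodBernoulli w).real (X ∩ Nᶜ) = (prodBernoulli w).real X := by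
  have h1 := measureReal_inter_add_sdiff (μ := prodBernoulli w) (s := X) (t := Nᶜ) MeasurableSet.of_discrete
  have h2 : (prodBernoulli w).real (X \ Nᶜ) ≤ (prodBernoulli w).real N := measureReal_mono (by intro ω hω; simpa using hω.2)
  have h3 : 0 ≤ (prodBernoulli w).real (X \ Nᶜ) := measureReal_nonneg
  linarith

end prob

/-- The real inequality: `αβ(1−αβ) ≤ α(1−β) + β(1−α)` on the unit square. [this work] -/
theorem poly_ineq {α β : ℝ} (ha0 : 0 ≤ α) (ha1 : α ≤ 1) (hb0 : 0 ≤ β) (hb1 : β ≤ 1) :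
    α * β * (1 - α * β) ≤ α * (1 - β) + β * (1 - α) := by
  have hid : α * (1 - β) + β * (1 - α) - α * β * (1 - α * β) =
      α * (1 - β) ^ 2 + β * (1 - α) ^ 2 + α * β * ((1 - α) * (1 - β)) := by ring
  nlinarith [mul_nonneg ha0 (sq_nonneg (1 - β)), mul_nonneg hb0 (sq_nonneg (1 - α)),
    mul_nonneg (mul_nonneg ha0 hb0) (mul_nonneg (sub_nonneg.2 ha1) (sub_nonneg.2 hb1))]

/-- **`(3PT)` when `c` separates `a` from `b`, on every finite weighted graph**: if `a ∈ S`, `b, c ∉ S` and every pair between `S` and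
`V ∖ (S ∪ {c})` has weight `0`, then `P(a↔b)·P(a↮b) ≤ P(a↔b, a↮c) + P(a↔c, a↮b) + P(b↔c, a↮b)`. [this work] -/
theorem threePointVariance_cutVertex (w : Sym2 V → unitInterval) {a b c : V} (S : Finset V) (ha : a ∈ S) (hb : b ∉ S) (hc : c ∉ S)
    (hw : ∀ u ∈ S, ∀ v, v ∉ S → v ≠ c → (w s(u, v) : ℝ) = 0) :
    (prodBernoulli w).real (openConn a b) * (prodBernoulli w).real (openConn a b)ᶜ ≤
      (prodBernoulli w).real (openConn a b ∩ (openConn a c)ᶜ) + (prodBernoulli w).real (openConn a c ∩ (openConn a b)ᶜ) +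
        (prodBernoulli w).real (openConn b c ∩ (openConn a b)ᶜ) := by
  have hN : (prodBernoulli w).real (bad S c) = 0 := real_bad w S c hw
  set RA := reachIn (insert c S) a c with hRA
  set RB := reachIn (Finset.univ.filter fun x => x ∉ S) b c with hRB
  have hdetA : DeterminedBy RA (↑(pairsIn (insert c S)) : Set (Sym2 V)) := determinedBy_reachIn _ a c
  have hdetB : DeterminedBy RB (↑(pairsIn (Finset.univ.filter fun x => x ∉ S)) : Set (Sym2 V)) := determinedBy_reachIn _ b c
  have hdisj := disjoint_pairsIn S c hc
  have hind : ∀ {X Y : Set (BondConfig V)}, DeterminedBy X (↑(pairsIn (insert c S)) : Set (Sym2 V)) →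
      DeterminedBy Y (↑(pairsIn (Finset.univ.filter fun x => x ∉ S)) : Set (Sym2 V)) →
      (prodBernoulli w).real (X ∩ Y) = (prodBernoulli w).real X * (prodBernoulli w).real Y :=
    fun hX hY => prodBernoulli_real_inter_of_determinedBy_disjoint w hdisj hX hY MeasurableSet.of_discrete MeasurableSet.of_discrete
  have hAc : (prodBernoulli w).real RAᶜ = 1 - (prodBernoulli w).real RA := probReal_compl_eq_one_sub MeasurableSet.of_discrete
  have hBc : (prodBernoulli w).real RBᶜ = 1 - (prodBernoulli w).real RB := probReal_compl_eq_one_sub MeasurableSet.of_discrete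
  -- event identities off the null event
  have eab : openConn a b ∩ (bad S c)ᶜ = (RA ∩ RB) ∩ (bad S c)ᶜ := by
    ext ω; simp only [mem_inter_iff, mem_compl_iff]
    constructor
    · rintro ⟨h, hn⟩
      obtain ⟨h1, h2⟩ := (openConn_ab_iff ha hb hn).1 h
      exact ⟨⟨(openConn_ac_iff ha hc hn).1 h1, (openConn_bc_iff hb hn).1 h2⟩, hn⟩
    · rintro ⟨⟨h1, h2⟩, hn⟩
      exact ⟨(openConn_ab_iff ha hb hn).2 ⟨(openConn_ac_iff ha hc hn).2 h1, (openConn_bc_iff hb hn).2 h2⟩, hn⟩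
  have eac : (RA ∩ RBᶜ) ∩ (bad S c)ᶜ ⊆ openConn a c ∩ (openConn a b)ᶜ := by
    rintro ω ⟨⟨h1, h2⟩, hn⟩
    refine ⟨(openConn_ac_iff ha hc hn).2 h1, fun h => h2 ?_⟩
    exact (openConn_bc_iff hb hn).1 ((openConn_ab_iff ha hb hn).1 h).2
  have ebc : (RAᶜ ∩ RB) ∩ (bad S c)ᶜ ⊆ openConn b c ∩ (openConn a b)ᶜ := by
    rintro ω ⟨⟨h1, h2⟩, hn⟩
    refine ⟨(openConn_bc_iff hb hn).2 h2, fun h => h1 ?_⟩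
    exact (openConn_ac_iff ha hc hn).1 ((openConn_ab_iff ha hb hn).1 h).1
  -- probabilities
  have hθ : (prodBernoulli w).real (openConn a b) = (prodBernoulli w).real RA * (prodBernoulli w).real RB := by
    rw [← real_inter_compl_of_null w hN (openConn a b), eab, real_inter_compl_of_null w hN, hind hdetA hdetB]
  have hθc : (prodBernoulli w).real (openConn a b)ᶜ = 1 - (prodBernoulli w).real (openConn a b) :=
    probReal_compl_eq_one_sub MeasurableSet.of_discrete
  have h2 : (prodBernoulli w).real RA * (1 - (prodBernoulli w).real RB) ≤ (prodBernoulli w).real (openConn a c ∩ (openConn a b)ᶜ) := by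
    rw [← hBc, ← hind hdetA (OneLayerTwoFinger.determinedBy_compl hdetB), ← real_inter_compl_of_null w hN (RA ∩ RBᶜ)]
    exact measureReal_mono eac
  have h3 : (1 - (prodBernoulli w).real RA) * (prodBernoulli w).real RB ≤ (prodBernoulli w).real (openConn b c ∩ (openConn a b)ᶜ) := by
    rw [← hAc, ← hind (OneLayerTwoFinger.determinedBy_compl hdetA) hdetB, ← real_inter_compl_of_null w hN (RAᶜ ∩ RB)]
    exact measureReal_mono ebc
  have h1 : 0 ≤ (prodBernoulli w).real (openConn a b ∩ (openConn a c)ᶜ) := measureReal_nonneg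
  have key := poly_ineq (α := (prodBernoulli w).real RA) (β := (prodBernoulli w).real RB) measureReal_nonneg measureReal_le_one
    measureReal_nonneg measureReal_le_one
  rw [hθc, hθ]
  nlinarith [key, h1, h2, h3]

end Summit.CriticalPhenomena.PercolationContinuityZ3.Theorems.ThreePointVarianceCutVertex
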